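import Mathlib.NumberTheory.Padics.RingHoms
import Mathlib.NumberTheory.Padics.ProperSpace
import Mathlib.LinearAlgebra.FreeModule.PID
import Mathlib.LinearAlgebra.Dimension.Constructions
import Mathlib.Algebra.NoZeroSMulDivisors.Pi
import Mathlib.Topology.Algebra.ContinuousMonoidHom
import Mathlib.Topology.Homeomorph.Lemmas
import HarnessLib

/-!
# Re-basing a family of `ℤ_p`-valued characters with open joint image (proofs only)

Topic `NumberTheory/EllipticCurves` (Iwasawa theory of `ℤ_p`-extensions); namespace
`Literature.NumberTheory.EllipticCurves.ZpExtension`.  No new definitions.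

Let `G` be a topological group and `κ₁, …, κ_n : G →ₜ* ℤ_p` continuous characters whose joint
image `Λ = {(κ_i g)_i} ⊆ ℤ_pⁿ` contains `p^N ℤ_pⁿ`.  Then `Λ` is a `ℤ_p`-submodule of finite
index, hence free of rank `n` (submodules of `ℤ_pⁿ`, `ℤ_p` a PID), and the coordinates of
`g ↦ (κ_i g)_i ∈ Λ` in a `ℤ_p`-basis of `Λ` are continuous characters `κ'_1, …, κ'_n` with
`(κ'_i) : G → ℤ_pⁿ` *surjective* (`exists_surjective_of_forall_exists`).  This is the passage
from "`Gal(M/K)` is an open subgroup of `ℤ_pⁿ`" to "`Gal(K̃/K) ≃ ℤ_pⁿ`", i.e. from `n`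
independent `ℤ_p`-valued characters to a `ℤ_pⁿ`-extension, used for the `ℤ_p`-rank of a number
field (Washington, *Introduction to Cyclotomic Fields*, §13.1, proof of Thm. 13.4: "`ℤ_p^{r₂+1}`
… has finite index in `Gal(K̃/K)` … therefore `Gal(K̃/K) ≃ ℤ_p^{r₂+1+δ}`"; Lang, *Cyclotomic
Fields I and II*, Ch. 5 §5, Thm. 5.2).  The rank-one case is
`Literature.NumberTheory.EllipticCurves.ZpExtension.exists_surjective_of_ne_one` (`ZpExtensionDihedralProofs`).

## Main results (all `theorem`s)

* `Literature.NumberTheory.EllipticCurves.ZpExtension.continuous_equivFun_of_isOpen`: for a `ℤ_p`-submodule `Λ ≤ ℤ_pⁿ` containing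
  `p^N ℤ_pⁿ` and a basis `b` of `Λ`, the coordinate map `Λ → ℤ_pⁿ` is continuous.
* `Literature.NumberTheory.EllipticCurves.ZpExtension.exists_surjective_and_forall_eq_sum`,
  `Literature.NumberTheory.EllipticCurves.ZpExtension.exists_surjective_of_forall_exists`: the re-basing statement above (with /
  without the change-of-basis relation `κ_j = ∑ c_{ji} κ'_i`).

## References

* L. C. Washington, *Introduction to Cyclotomic Fields*, 2nd ed., GTM 83, Springer 1997, §13.1,
  Thm. 13.4 and its proof.
* S. Lang, *Cyclotomic Fields I and II*, GTM 121, Springer 1990, Ch. 5 §5, Thm. 5.2.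
-/

noncomputable section

open Topology Module

namespace Literature.NumberTheory.EllipticCurves

namespace ZpExtension

variable {p : ℕ} [Fact p.Prime] {n : ℕ}

/-- A subgroup of `ℤ_pⁿ` containing `p^N ℤ_pⁿ` is a `ℤ_p`-submodule: `c = m + p^N c'` with `m ∈ ℕ`
(`PadicInt.appr`), and `m • x`, `p^N (c' • x)` both lie in it.  Ref: Washington, *Introduction to
Cyclotomic Fields*, §13.1 (closed subgroups of finite index of `ℤ_pⁿ` are `ℤ_p`-lattices).
[folklore] -/
theorem smul_mem_of_forall_exists (Λ : AddSubgroup (Fin n → ℤ_[p])) (N : ℕ)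
    (hN : ∀ x : Fin n → ℤ_[p], (fun i => (p : ℤ_[p]) ^ N * x i) ∈ Λ)
    (c : ℤ_[p]) {x : Fin n → ℤ_[p]} (hx : x ∈ Λ) : c • x ∈ Λ := by
  obtain ⟨c', hc'⟩ := Ideal.mem_span_singleton'.1 (PadicInt.appr_spec N c)
  have hc : c = (c.appr N : ℤ_[p]) + (p : ℤ_[p]) ^ N * c' := by
    rw [mul_comm, hc']; ring
  have h1 : ((c.appr N : ℕ) : ℤ_[p]) • x ∈ Λ := by
    rw [Nat.cast_smul_eq_nsmul]
    exact Λ.nsmul_mem hx _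
  have h2 : ((p : ℤ_[p]) ^ N * c') • x ∈ Λ := by
    have := hN (c' • x)
    convert this using 1
    ext i
    simp only [Pi.smul_apply, smul_eq_mul]
    ring
  rw [hc, add_smul]
  exact Λ.add_mem h1 h2

/-- **Coordinates on a finite-index lattice are continuous.**  Let `Λ ≤ ℤ_pⁿ` be a
`ℤ_p`-submodule containing `p^N ℤ_pⁿ` and `b` a `ℤ_p`-basis of `Λ` indexed by a finite type.
Then the coordinate isomorphism `b.equivFun : Λ → ℤ_p^ι` is continuous for the subspace topology
on `Λ`: its inverse `c ↦ ∑ cᵢ bᵢ` is a continuous bijection from the compact space `ℤ_p^ι` onto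
the Hausdorff space `Λ`, hence a homeomorphism.  Ref: Washington, *Introduction to Cyclotomic
Fields*, §13.1. [folklore] -/
theorem continuous_equivFun {ι : Type*} [Fintype ι] (Λ : Submodule ℤ_[p] (Fin n → ℤ_[p]))
    (b : Basis ι ℤ_[p] Λ) : Continuous b.equivFun := by
  -- the inverse is continuous
  have hsymm : Continuous (b.equivFun.symm : (ι → ℤ_[p]) → Λ) := by
    refine continuous_induced_rng.2 ?_
    have heq : (Subtype.val ∘ (b.equivFun.symm : (ι → ℤ_[p]) → Λ)) =
        fun c => ∑ i, c i • (b i : Fin n → ℤ_[p]) := by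
      funext c
      simp only [Function.comp_apply, Basis.equivFun_symm_apply, Submodule.coe_sum,
        Submodule.coe_smul]
    rw [heq]
    exact continuous_finsetSum _ fun i _ => (continuous_apply i).smul continuous_const
  let e : (ι → ℤ_[p]) ≃ₜ Λ :=
    Continuous.homeoOfEquivCompactToT2 (f := b.equivFun.symm.toEquiv) hsymm
  have he : ∀ x : Λ, b.equivFun x = e.symm x := fun x => by
    apply e.injective
    change b.equivFun.symm (b.equivFun x) = e (e.symm x)
    rw [LinearEquiv.symm_apply_apply, Homeomorph.apply_symm_apply]
  have : (b.equivFun : Λ → ι → ℤ_[p]) = e.symm := funext he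
  rw [this]
  exact e.symm.continuous

/-- **Re-basing characters with open joint image.**  Let `κ₁, …, κ_n : G →ₜ* ℤ_p` be continuous
characters of a topological group whose joint image contains `p^N ℤ_pⁿ` (every `p^N x` is a
joint value).  Then there are continuous characters `κ'_1, …, κ'_n : G →ₜ* ℤ_p` with
`g ↦ (κ'_i g)_i : G → ℤ_pⁿ` surjective — the coordinates of `(κ_i)` in a `ℤ_p`-basis of the
joint image `Λ`, a free `ℤ_p`-module of rank `n` (`Λ ⊇ p^N ℤ_pⁿ` has full rank; submodules of
`ℤ_pⁿ` over the PID `ℤ_p` are free, Mathlib's Smith normal form).  This is the step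
"`⊕ ℤ_p κ_i` of finite index in `Hom(Gal(K̃/K), ℤ_p)` ⇒ `Gal(K̃/K) ≃ ℤ_pⁿ`" in the computation
of the `ℤ_p`-rank of a number field.  This version also records that each `κ_j` is a
`ℤ_p`-combination of the `κ'_i` (the `j`-th coordinates of the basis vectors).
Ref: Washington, *Introduction to Cyclotomic Fields*, §13.1, proof of Thm. 13.4; Lang,
*Cyclotomic Fields I and II*, Ch. 5 §5, Thm. 5.2. [folklore] -/
theorem exists_surjective_and_forall_eq_sum {G : Type*} [Group G] [TopologicalSpace G]
    (κ : Fin n → (G →ₜ* Multiplicative ℤ_[p])) (N : ℕ)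
    (h : ∀ x : Fin n → ℤ_[p], ∃ g : G, ∀ i, (κ i g).toAdd = (p : ℤ_[p]) ^ N * x i) :
    ∃ κ' : Fin n → (G →ₜ* Multiplicative ℤ_[p]),
      (Function.Surjective fun (g : G) (i : Fin n) => (κ' i g).toAdd) ∧
      ∀ j, ∃ c : Fin n → ℤ_[p], ∀ g, (κ j g).toAdd = ∑ i, c i * (κ' i g).toAdd := by
  classical
  -- the joint character, additively
  set w : G → (Fin n → ℤ_[p]) := fun g i => (κ i g).toAdd with hw_def
  have hw_mul : ∀ g g' : G, w (g * g') = w g + w g' := fun g g' => by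
    funext i
    simp only [hw_def, map_mul, toAdd_mul, Pi.add_apply]
  have hw_one : w 1 = 0 := by
    funext i
    simp only [hw_def, map_one, toAdd_one, Pi.zero_apply]
  have hw_pow : ∀ (g : G) (m : ℕ), w (g ^ m) = m • w g := fun g m => by
    induction m with
    | zero => rw [pow_zero, hw_one, zero_smul]
    | succ m ih => rw [pow_succ, hw_mul, ih, succ_nsmul]
  have hw_cont : Continuous w :=
    continuous_pi fun i => continuous_toAdd.comp (κ i).continuous
  -- its image, a subgroup containing `p^N ℤ_pⁿ`, hence a `ℤ_p`-submodule
  let Λ₀ : AddSubgroup (Fin n → ℤ_[p]) :=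
    { carrier := Set.range w
      zero_mem' := ⟨1, hw_one⟩
      add_mem' := by
        rintro _ _ ⟨g, rfl⟩ ⟨g', rfl⟩
        exact ⟨g * g', hw_mul g g'⟩
      neg_mem' := by
        rintro _ ⟨g, rfl⟩
        refine ⟨g⁻¹, ?_⟩
        have h1 := hw_mul g⁻¹ g
        rw [inv_mul_cancel, hw_one] at h1
        exact eq_neg_of_add_eq_zero_left h1.symm }
  have hN : ∀ x : Fin n → ℤ_[p], (fun i => (p : ℤ_[p]) ^ N * x i) ∈ Λ₀ := fun x => by
    obtain ⟨g, hg⟩ := h x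
    exact ⟨g, funext hg⟩
  let Λ : Submodule ℤ_[p] (Fin n → ℤ_[p]) :=
    { carrier := Set.range w
      zero_mem' := Λ₀.zero_mem
      add_mem' := fun ha hb => Λ₀.add_mem ha hb
      smul_mem' := fun c x hx => smul_mem_of_forall_exists Λ₀ N hN c hx }
  have hmemΛ : ∀ g, w g ∈ Λ := fun g => ⟨g, rfl⟩
  -- `Λ` has full rank
  have hrank : Module.finrank ℤ_[p] Λ = Module.finrank ℤ_[p] (Fin n → ℤ_[p]) := by
    apply le_antisymm (Submodule.finrank_le Λ)
    let f : (Fin n → ℤ_[p]) →ₗ[ℤ_[p]] (Fin n → ℤ_[p]) := (p : ℤ_[p]) ^ N • LinearMap.id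
    have hf : Function.Injective f := by
      intro x y hxy
      have hpN : (p : ℤ_[p]) ^ N ≠ 0 := pow_ne_zero _ (by exact_mod_cast (Fact.out : p.Prime).ne_zero)
      exact smul_right_injective _ hpN hxy
    have hle : LinearMap.range f ≤ Λ := by
      rintro _ ⟨x, rfl⟩
      exact hN x
    calc Module.finrank ℤ_[p] (Fin n → ℤ_[p])
        = Module.finrank ℤ_[p] (LinearMap.range f) := (LinearMap.finrank_range_of_inj hf).symm
      _ ≤ Module.finrank ℤ_[p] Λ := Submodule.finrank_mono hle
  -- a basis of `Λ` indexed by `Fin n`, and the (continuous) coordinates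
  let b : Basis (Fin n) ℤ_[p] Λ := Submodule.smithNormalFormBotBasis (Pi.basisFun ℤ_[p] (Fin n)) hrank
  have hb : Continuous b.equivFun := continuous_equivFun Λ b
  let wΛ : G → Λ := fun g => ⟨w g, hmemΛ g⟩
  have hwΛ_cont : Continuous wΛ := continuous_induced_rng.2 hw_cont
  have hwΛ_mul : ∀ g g', wΛ (g * g') = wΛ g + wΛ g' := fun g g' => Subtype.ext (hw_mul g g')
  have hwΛ_one : wΛ 1 = 0 := Subtype.ext hw_one
  let κ' : Fin n → (G →ₜ* Multiplicative ℤ_[p]) := fun i =>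
    { toFun := fun g => Multiplicative.ofAdd (b.equivFun (wΛ g) i)
      map_one' := by
        simp only [hwΛ_one, map_zero, Pi.zero_apply, ofAdd_zero]
      map_mul' := fun g g' => by
        rw [hwΛ_mul, map_add, Pi.add_apply, ofAdd_add]
      continuous_toFun :=
        continuous_ofAdd.comp ((continuous_apply i).comp (hb.comp hwΛ_cont)) }
  refine ⟨κ', fun x => ?_, fun j => ⟨fun i => ((b i : Λ) : Fin n → ℤ_[p]) j, fun g => ?_⟩⟩
  · obtain ⟨g, hg⟩ : (b.equivFun.symm x : Fin n → ℤ_[p]) ∈ Set.range w := (b.equivFun.symm x).2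
    refine ⟨g, ?_⟩
    have hgΛ : wΛ g = b.equivFun.symm x := Subtype.ext hg
    funext i
    change (Multiplicative.ofAdd (b.equivFun (wΛ g) i)).toAdd = x i
    rw [toAdd_ofAdd, hgΛ, LinearEquiv.apply_symm_apply]
  · -- `w g = ∑ᵢ (coordᵢ g) • bᵢ`, read off at the `j`-th component
    have h1 : ((wΛ g : Λ) : Fin n → ℤ_[p]) = ∑ i, b.equivFun (wΛ g) i • ((b i : Λ) : Fin n → ℤ_[p]) := by
      conv_lhs => rw [← b.sum_equivFun (wΛ g)]
      rw [Submodule.coe_sum]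
      exact Finset.sum_congr rfl fun i _ => Submodule.coe_smul _ _
    have h2 := congrFun h1 j
    change w g j = _ at h2
    change (κ j g).toAdd = ∑ i, ((b i : Λ) : Fin n → ℤ_[p]) j * (Multiplicative.ofAdd (b.equivFun (wΛ g) i)).toAdd
    have hw : w g j = (κ j g).toAdd := rfl
    rw [← hw, h2, Finset.sum_apply]
    exact Finset.sum_congr rfl fun i _ => by rw [Pi.smul_apply, smul_eq_mul, toAdd_ofAdd, mul_comm]


/-- **Re-basing characters with open joint image** (surjectivity only; see
`exists_surjective_and_forall_eq_sum` for the version recording the change of basis).  Let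
`κ₁, …, κ_n : G →ₜ* ℤ_p` be continuous characters of a topological group whose joint image
contains `p^N ℤ_pⁿ`.  Then there are continuous characters `κ'_1, …, κ'_n : G →ₜ* ℤ_p` with
`g ↦ (κ'_i g)_i : G → ℤ_pⁿ` surjective.
Ref: Washington, *Introduction to Cyclotomic Fields*, §13.1, proof of Thm. 13.4; Lang,
*Cyclotomic Fields I and II*, Ch. 5 §5, Thm. 5.2. [folklore] -/
theorem exists_surjective_of_forall_exists {G : Type*} [Group G] [TopologicalSpace G]
    (κ : Fin n → (G →ₜ* Multiplicative ℤ_[p])) (N : ℕ)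
    (h : ∀ x : Fin n → ℤ_[p], ∃ g : G, ∀ i, (κ i g).toAdd = (p : ℤ_[p]) ^ N * x i) :
    ∃ κ' : Fin n → (G →ₜ* Multiplicative ℤ_[p]),
      Function.Surjective fun (g : G) (i : Fin n) => (κ' i g).toAdd := by
  obtain ⟨κ', hκ', -⟩ := exists_surjective_and_forall_eq_sum κ N h
  exact ⟨κ', hκ'⟩

end ZpExtension

end Literature.NumberTheory.EllipticCurves
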